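import Summits.QuantumFields.YangMills.Theorems.BalabanUVNodesSpineReadingOfRecord13CoPHV
import Summits.QuantumFields.YangMills.Theorems.BalabanUVNodesSpineCarriersOfRecord13CoPHCmap

/-!
# THE SPINE READING OF RECORD, χ-GENERIC («Cmap» ∕ Chi EDITION) — `histA₁₃Chi ∕ keyA₁₃Chi ∕ classSet₁₃Chi ∕ weightA₁₃Chi ∕ badClass₁₃Chi ∕ ShellSplit₁₃CoPHCmap ∕
# crOfRecord₁₃AtCmap ∕ crOfRecord₁₃VAtCmap`: this lineage's `…SpineReadingOfRecord13CoPH(V)` objects RE-ISSUED over the β-slot `χ : ChiSlot F N` of [Ax-3b]∕[Ax-3c]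
# (histories `gOfRecord₁₃Chi`, datum `datumOfRecord₁₃CoPHChi θ χ hP`, binder `θ.Provisos₁₃CoPHChi F N χ` — re-centred COHERENTLY, plan g99 σ5-d), with the receipts at the record's
# own slot `χ := chiβOfRecord₁₃ θ` (ALL `rfl`) and the RE-CENTRED instances `…Ax` (`χ := chiβOfRecord₁₃Ax θ`)

Cell `pub-ymgap`, YM-PLAN Track A (HUMAN RULING D-0062); seat `pub-ymgap-dag-n20-d` (g45) — op 5c (a) T3 of HANDS-4 (dag-lead g40 WORDS 593 GO to the OWNER LINEAGE: g28 ✓p587226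
`…SpineReadingOfRecord13CoPH` ∕ ✓p590105 `…CoPHV` authored the parents), supply for K3ᴬ `SpineGivenEndpointR13SepCoPHVAx` (stmt-QuantumFields-27247; plan g99 memo OP5C-SUPPLY σ4∕σ5;
node00-def-RR-2 GATE-0 Q-TRANSPORT = NO, I.21769: no parent tuple carries the Ax datum, so per-file χ-twins in the [Ax-3c] pattern).  `--kind definition --supports stmt-QuantumFields-27247
--as helper`; COUNT-NEUTRAL.  Imports the parents (`…SpineReadingOfRecord13CoPHV` ⊇ `…CoPH`: `runA₁₃ ∕ runB₁₃` are χ-FREE and reused as is; the canonical weights `wInf ∕ wshInf ∕ deltaCan`)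
and T2 `…SpineCarriersOfRecord13CoPHCmap` (the χ-generic reading TYPE `SpineReading₁₃CoPHCmap N Χ`, `Χ : (F : T4Family) → Stage13Params F N → ChiSlot F N`).  NOTHING of record is
edited (body-freeze): every declaration below is the VERBATIM body of the like-named parent declaration with exactly the substitutions `histA₁₃ ↦ histA₁₃Chi θ χ` (`gOfRecord₁₃ ↦
gOfRecord₁₃Chi … χ`), `datumOfRecord₁₃CoPH θ hP ↦ datumOfRecord₁₃CoPHChi θ χ hP`, `θ.Provisos₁₃CoPH ↦ θ.Provisos₁₃CoPHChi F N χ`, names `X ↦ XChi` (θ-level slot `χ`) ∕ `XCmap` (family-level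
slot reading `Χ`, for the TYPES and the readings), `abbrev XAx := XChi … (chiβOfRecord₁₃Ax …)`.

WHY.  K3ᴬ v8 re-keys the spine at the RE-CENTRED record (`θ.Provisos₁₃CoPHAx`, `datumOfRecord₁₃CoPHAx`); the parents read `(θ, hP : θ.Provisos₁₃CoPH)` NOT phantom-ly — `weightA₁₃ θ hP`
sums `classWeightOfDatum₉ … (datumOfRecord₁₃CoPH F N θ hP) …` over histories classed by `keyA₁₃` on `SeqOfRecord … (histA₁₃ …)` (plan g99 FINDING 1) —, so the Ax world needs the SAME
objects with histories ∕ datum ∕ provisos read at ONE β-slot (σ5-d: coherent re-centring).  The χ-generic edition serves every slot; the parent is recovered at `χ := chiβOfRecord₁₃ θ` BY `rfl`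
(§5: `gOfRecord₁₃Chi_chiβ`, `datumOfRecord₁₃CoPHChi_chiβ` are `rfl`, the proviso receipt is field-wise and proof-irrelevant), the Ax instances are one-line `abbrev`s (§6).

WHAT IS DEFINED ∕ PROVED (definitions + `rfl` bookkeeping; zero `sorry`).  §1 `histA₁₃Chi ∕ histB₁₃Chi` (+ `_zero`) · §2 `keyA₁₃Chi ∕ keyB₁₃Chi` (+ `keyB₁₃Chi_eq`), `classSet₁₃Chi`,
`weightA₁₃Chi ∕ weightB₁₃Chi`, `badClass₁₃Chi` (+ `_subset`) · §3 the TYPE `ShellSplit₁₃CoPHCmap N Χ K₀` and the readings `crOfRecord₁₃AtCmap Χ K₀ jcut sh ∕ crOfRecord₁₃Cmap ∕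
crOfRecord₁₃VAtCmap ∕ crOfRecord₁₃VCmap : SpineReading₁₃CoPHCmap N Χ` (`l₀ := 1`, `vol := 1 ∕ F.side⁴`, canonical `W ∕ Wsh ∕ δ`) · §4 the `rfl` dictionary (both volume letters) · §5 RECEIPTS at
`χ := chiβOfRecord₁₃ θ`, all `rfl`: `histA∕B₁₃Chi_chiβ`, `keyA∕B₁₃Chi_chiβ`, `classSet₁₃Chi_chiβ`, `weightA∕B₁₃Chi_chiβ`, `badClass₁₃Chi_chiβ`, `crOfRecord₁₃(V)AtCmap_chiβ` (= the parent
reading at the transported provisos, the shell split read back through them) · §6 Ax instances `histA∕B₁₃Ax`, `classSet₁₃Ax`, `weightA∕B₁₃Ax` (binder `θ.Provisos₁₃CoPHAx`), `badClass₁₃Ax`,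
`ShellSplit₁₃CoPHAx`, `crOfRecord₁₃AtAx ∕ crOfRecord₁₃Ax ∕ crOfRecord₁₃VAtAx ∕ crOfRecord₁₃VAx : SpineReading₁₃CoPHAx N` · §7 face transfers `relWeightBound_∕shellWeightBound_crOfRecord₁₃(V)AtCmap`
(ANY witness at the χ-carriers gives the face AT the χ-reading, whose `W ∕ Wsh` are canonical).  NOT here (faces, op 5c (b)): the parents' §5 extraction theorems
`keyedExtraction_crOfRecord₁₃(V)At` at the χ-datum — they re-prove over n19-d B‴ at `datumOfRecord₁₃CoPHChi` once its B1 row `isPrintedAveraged` is cited at the χ-datum.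

HONEST FRAMING.  DEFINITIONS re-issued over a parameter + `rfl` receipts + two generic transfers; NO estimate; nothing of Bałaban's asserted, ported or discharged; no
`Provisos₁₃CoPHChi ∕ …Ax` inhabitant claimed (K0 open); K-Ax cruxes 3∕3 OPEN; N19 ∕ N20 ∕ N21 ∕ N27 NOT discharged; counts UNMOVED (typed 28∕28 · discharged 8∕27); one finite
four-torus programme at fixed `ε` — NOT ℝ⁴, NOT OS, NOT a mass gap, NOT the Clay problem.  No `instance`, no `notation`, no `sorry`; no decl below carries a cite tag.
-/

noncomputable section

open scoped BigOperators
open Finset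

namespace YMDAG.UVSplit

open Literature.MathematicalPhysics.QuantumFieldTheory.Balaban1983to89
open Literature.MathematicalPhysics.QuantumFieldTheory.Balaban1983to89.T4Continuum
open Literature.MathematicalPhysics.QuantumFieldTheory.Balaban1983to89.Node00
open T4WeightBudget (RelWeightBound)
open T4IndicatorShell (ShellWeightBound)
open Summit.QuantumFields.BalabanUV.T4Continuum.Spine
open Summit.QuantumFields.YangMills.BalabanUVNodes.SpineCanonicalWeights

variable {F : T4Family} {N : ℕ} [NeZero N]

/-! ## §1 The run histories over the β-slot `χ` -/

/-- **RUN A's HISTORY OF RECORD over the β-slot `χ`**: `gOfRecord₁₃Chi θ χ (runA₁₃ K₀ g₀ K)` (the run letters `runA₁₃ ∕ runB₁₃` are χ-free and reused). [bookkeeping] -/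
def histA₁₃Chi (θ : Stage13HParams F N) (χ : ChiSlot F N) (K₀ : ℕ) (g₀ : ℕ → ℝ) (K : ℕ) : ℕ → ℝ :=
  gOfRecord₁₃Chi F N θ.toStage13Params χ (runA₁₃ F K₀ g₀ K)

/-- **RUN B's HISTORY OF RECORD over the β-slot `χ`**. [bookkeeping] -/
def histB₁₃Chi (θ : Stage13HParams F N) (χ : ChiSlot F N) (K₀ : ℕ) (g₀ : ℕ → ℝ) (K : ℕ) : ℕ → ℝ :=
  gOfRecord₁₃Chi F N θ.toStage13Params χ (runB₁₃ F K₀ g₀ K)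

/-- Run A's χ-history starts at the dressing's coupling `g₀ (K₀ + K)`. [bookkeeping] -/
theorem histA₁₃Chi_zero (θ : Stage13HParams F N) (χ : ChiSlot F N) (K₀ : ℕ) (g₀ : ℕ → ℝ) (K : ℕ) :
    histA₁₃Chi θ χ K₀ g₀ K 0 = g₀ (runA₁₃ F K₀ g₀ K).K :=
  FlowStepRuns.genSeq_zero _ _

/-- Run B's χ-history starts at `g₀ (K₀ + K + 1)`. [bookkeeping] -/
theorem histB₁₃Chi_zero (θ : Stage13HParams F N) (χ : ChiSlot F N) (K₀ : ℕ) (g₀ : ℕ → ℝ) (K : ℕ) :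
    histB₁₃Chi θ χ K₀ g₀ K 0 = g₀ (runB₁₃ F K₀ g₀ K).K :=
  FlowStepRuns.genSeq_zero _ _

/-! ## §2 Keys, class set, class weights, bad class over the β-slot `χ` -/

section Data

variable (θ : Stage13HParams F N) (χ : ChiSlot F N) (hP : θ.Provisos₁₃CoPHChi F N χ) (K₀ : ℕ) (g₀ : ℕ → ℝ) (os : List (ULoop F))

/-- **RUN A's σ-PACKED KEY OF RECORD over `χ`** `s ↦ ⟨K, twoRunKeyA … s⟩`. [bookkeeping] -/
def keyA₁₃Chi (K : ℕ) (s : SeqOfRecord F θ.ν θ.τ9.M (histA₁₃Chi θ χ K₀ g₀ K) (K₀ + K) (K₀ + K)) : Σ K, SiteSeqKey F (K₀ + K) :=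
  ⟨K, twoRunKeyA F θ.ν θ.τ9.M (histA₁₃Chi θ χ K₀ g₀ K) (K₀ + K) (K₀ + K) s⟩

/-- **RUN B's σ-PACKED KEY OF RECORD over `χ`** (total; the junk `∅`-key off `0 < θ.τ9.M`). [bookkeeping] -/
def keyB₁₃Chi (K : ℕ) (s' : SeqOfRecord F θ.ν θ.τ9.M (histB₁₃Chi θ χ K₀ g₀ K) (K₀ + K + 1) (K₀ + K + 1)) : Σ K, SiteSeqKey F (K₀ + K) :=
  if hM : 0 < θ.τ9.M then ⟨K, twoRunKeyB F θ.ν hM (histB₁₃Chi θ χ K₀ g₀ K) (K₀ + K) (K₀ + K) s'⟩ else ⟨K, (fun _ => ∅, fun _ => ∅)⟩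

/-- Under `0 < θ.τ9.M` run B's χ-key IS node U5d's `twoRunKeyB`. [bookkeeping] -/
theorem keyB₁₃Chi_eq (hM : 0 < θ.τ9.M) (K : ℕ) (s' : SeqOfRecord F θ.ν θ.τ9.M (histB₁₃Chi θ χ K₀ g₀ K) (K₀ + K + 1) (K₀ + K + 1)) :
    keyB₁₃Chi θ χ K₀ g₀ K s' = ⟨K, twoRunKeyB F θ.ν hM (histB₁₃Chi θ χ K₀ g₀ K) (K₀ + K) (K₀ + K) s'⟩ := by
  simp [keyB₁₃Chi, hM]

/-- **THE CLASS SET OF RECORD over `χ`** at step `K`. [bookkeeping] -/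
def classSet₁₃Chi (K : ℕ) : Finset (Σ K, SiteSeqKey F (K₀ + K)) :=
  letI : ∀ Kc, DecidableEq (SiteSeqKey F Kc) := fun _ => Classical.decEq _
  univ.image (keyA₁₃Chi θ χ K₀ g₀ K) ∪ univ.image (keyB₁₃Chi θ χ K₀ g₀ K)

/-- **RUN A's CLASS WEIGHT OF RECORD over `χ`** at a key: the fibre sum of F3's dressed class weights of the tuple's own family at the χ-generic CoPH datum
`datumOfRecord₁₃CoPHChi θ χ hP`. [bookkeeping] -/
def weightA₁₃Chi (K : ℕ) (t : ℝ) (x : Σ K, SiteSeqKey F (K₀ + K)) : ℝ :=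
  letI : ∀ Kc, DecidableEq (SiteSeqKey F Kc) := fun _ => Classical.decEq _
  ∑ s ∈ univ.filter (fun s => keyA₁₃Chi θ χ K₀ g₀ K s = x),
    classWeightOfDatum₉ F N θ.toStage9Params (datumOfRecord₁₃CoPHChi F N θ χ hP) g₀ os (runA₁₃ F K₀ g₀ K) (histA₁₃Chi θ χ K₀ g₀ K) (K₀ + K) t s

/-- **RUN B's CLASS WEIGHT OF RECORD over `χ`** at a key. [bookkeeping] -/
def weightB₁₃Chi (K : ℕ) (t : ℝ) (x : Σ K, SiteSeqKey F (K₀ + K)) : ℝ :=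
  letI : ∀ Kc, DecidableEq (SiteSeqKey F Kc) := fun _ => Classical.decEq _
  ∑ s' ∈ univ.filter (fun s' => keyB₁₃Chi θ χ K₀ g₀ K s' = x),
    classWeightOfDatum₉ F N θ.toStage9Params (datumOfRecord₁₃CoPHChi F N θ χ hP) g₀ os (runB₁₃ F K₀ g₀ K) (histB₁₃Chi θ χ K₀ g₀ K) (K₀ + K + 1) t s'

/-- **THE BAD CLASS OF RECORD over `χ`** under the persistence policy `jcut`. [bookkeeping] -/
def badClass₁₃Chi (jcut : ℕ → ℕ) (K : ℕ) (_t : ℝ) : Finset (Σ K, SiteSeqKey F (K₀ + K)) :=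
  badKeysSigma F (classSet₁₃Chi θ χ K₀ g₀ K) jcut

/-- The χ-bad class consists of χ-classes. [bookkeeping] -/
theorem badClass₁₃Chi_subset (jcut : ℕ → ℕ) (K : ℕ) (t : ℝ) : badClass₁₃Chi θ χ K₀ g₀ jcut K t ⊆ classSet₁₃Chi θ χ K₀ g₀ K :=
  badKeysSigma_subset F _ jcut

end Data

/-! ## §3 The readings over a family-level β-slot reading `Χ` -/

/-- **A KEYED SHELL SPLIT off the χ-keyed Stage-13 tuples**: as `ShellSplit₁₃CoPH`, the proviso binder read at the β-slot `Χ F θ.toStage13Params`. The TYPE only. [bookkeeping] -/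
abbrev ShellSplit₁₃CoPHCmap (N : ℕ) [NeZero N] (Χ : (F : T4Family) → Stage13Params F N → ChiSlot F N) (K₀ : ℕ) : Type 1 :=
  (F : T4Family) → (θ : Stage13HParams F N) → θ.Provisos₁₃CoPHChi F N (Χ F θ.toStage13Params) → (ℕ → ℝ) → List (ULoop F) →
    (ℕ → ℝ → (Σ K, SiteSeqKey F (K₀ + K)) → ℝ) × (ℕ → ℝ → (Σ K, SiteSeqKey F (K₀ + K)) → ℝ)

/-- **THE SPINE READING OF RECORD AT OFFSET `K₀` over `Χ`** — `crOfRecord₁₃At` with every object read at the β-slot `Χ F θ.toStage13Params` and the χ-generic CoPH datum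
(`l₀ := 1`, `vol := 1`, canonical `W ∕ Wsh ∕ δ`). [bookkeeping] -/
def crOfRecord₁₃AtCmap (Χ : (F : T4Family) → Stage13Params F N → ChiSlot F N) (K₀ : ℕ) (jcut : ℕ → ℕ) (sh : ShellSplit₁₃CoPHCmap N Χ K₀) :
    SpineReading₁₃CoPHCmap N Χ :=
  fun F θ hP g₀ os =>
  { ι := Σ K, SiteSeqKey F (K₀ + K)
    dec := Classical.decEq _
    l₀ := 1
    vol := 1
    K₀ := K₀
    T := classSet₁₃Chi θ (Χ F θ.toStage13Params) K₀ g₀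
    A := weightA₁₃Chi θ (Χ F θ.toStage13Params) hP K₀ g₀ os
    B := weightB₁₃Chi θ (Χ F θ.toStage13Params) hP K₀ g₀ os
    shA := (sh F θ hP g₀ os).1
    shB := (sh F θ hP g₀ os).2
    Bad := badClass₁₃Chi θ (Χ F θ.toStage13Params) K₀ g₀ jcut
    W := wInf 1 (classSet₁₃Chi θ (Χ F θ.toStage13Params) K₀ g₀) (weightA₁₃Chi θ (Χ F θ.toStage13Params) hP K₀ g₀ os)
      (weightB₁₃Chi θ (Χ F θ.toStage13Params) hP K₀ g₀ os) (badClass₁₃Chi θ (Χ F θ.toStage13Params) K₀ g₀ jcut)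
    Wsh := wshInf 1 (classSet₁₃Chi θ (Χ F θ.toStage13Params) K₀ g₀) (weightA₁₃Chi θ (Χ F θ.toStage13Params) hP K₀ g₀ os)
      (weightB₁₃Chi θ (Χ F θ.toStage13Params) hP K₀ g₀ os) (sh F θ hP g₀ os).1 (sh F θ hP g₀ os).2
    δ := letI : DecidableEq (Σ K, SiteSeqKey F (K₀ + K)) := Classical.decEq _
      deltaCan 1 1 (classSet₁₃Chi θ (Χ F θ.toStage13Params) K₀ g₀) (badClass₁₃Chi θ (Χ F θ.toStage13Params) K₀ g₀ jcut)
        (fun K t x => weightA₁₃Chi θ (Χ F θ.toStage13Params) hP K₀ g₀ os K t x - (sh F θ hP g₀ os).1 K t x)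
        (fun K t x => weightB₁₃Chi θ (Χ F θ.toStage13Params) hP K₀ g₀ os K t x - (sh F θ hP g₀ os).2 K t x) }

/-- **THE SPINE READING OF RECORD over `Χ`** `:= crOfRecord₁₃AtCmap Χ 0`. [bookkeeping] -/
def crOfRecord₁₃Cmap (Χ : (F : T4Family) → Stage13Params F N → ChiSlot F N) (jcut : ℕ → ℕ) (sh : ShellSplit₁₃CoPHCmap N Χ 0) :
    SpineReading₁₃CoPHCmap N Χ :=
  crOfRecord₁₃AtCmap Χ 0 jcut sh

/-- **THE SPINE READING OF RECORD AT OFFSET `K₀` over `Χ`, PHYSICAL VOLUME LETTER** — `crOfRecord₁₃VAt` (`vol := F.side ^ 4`) read at the β-slot. [bookkeeping] -/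
def crOfRecord₁₃VAtCmap (Χ : (F : T4Family) → Stage13Params F N → ChiSlot F N) (K₀ : ℕ) (jcut : ℕ → ℕ) (sh : ShellSplit₁₃CoPHCmap N Χ K₀) :
    SpineReading₁₃CoPHCmap N Χ :=
  fun F θ hP g₀ os =>
  { ι := Σ K, SiteSeqKey F (K₀ + K)
    dec := Classical.decEq _
    l₀ := 1
    vol := F.side ^ 4
    K₀ := K₀
    T := classSet₁₃Chi θ (Χ F θ.toStage13Params) K₀ g₀
    A := weightA₁₃Chi θ (Χ F θ.toStage13Params) hP K₀ g₀ os
    B := weightB₁₃Chi θ (Χ F θ.toStage13Params) hP K₀ g₀ os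
    shA := (sh F θ hP g₀ os).1
    shB := (sh F θ hP g₀ os).2
    Bad := badClass₁₃Chi θ (Χ F θ.toStage13Params) K₀ g₀ jcut
    W := wInf 1 (classSet₁₃Chi θ (Χ F θ.toStage13Params) K₀ g₀) (weightA₁₃Chi θ (Χ F θ.toStage13Params) hP K₀ g₀ os)
      (weightB₁₃Chi θ (Χ F θ.toStage13Params) hP K₀ g₀ os) (badClass₁₃Chi θ (Χ F θ.toStage13Params) K₀ g₀ jcut)
    Wsh := wshInf 1 (classSet₁₃Chi θ (Χ F θ.toStage13Params) K₀ g₀) (weightA₁₃Chi θ (Χ F θ.toStage13Params) hP K₀ g₀ os)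
      (weightB₁₃Chi θ (Χ F θ.toStage13Params) hP K₀ g₀ os) (sh F θ hP g₀ os).1 (sh F θ hP g₀ os).2
    δ := letI : DecidableEq (Σ K, SiteSeqKey F (K₀ + K)) := Classical.decEq _
      deltaCan 1 (F.side ^ 4) (classSet₁₃Chi θ (Χ F θ.toStage13Params) K₀ g₀) (badClass₁₃Chi θ (Χ F θ.toStage13Params) K₀ g₀ jcut)
        (fun K t x => weightA₁₃Chi θ (Χ F θ.toStage13Params) hP K₀ g₀ os K t x - (sh F θ hP g₀ os).1 K t x)
        (fun K t x => weightB₁₃Chi θ (Χ F θ.toStage13Params) hP K₀ g₀ os K t x - (sh F θ hP g₀ os).2 K t x) }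

/-- **THE SPINE READING OF RECORD over `Χ`, PHYSICAL VOLUME LETTER** `:= crOfRecord₁₃VAtCmap Χ 0`. [bookkeeping] -/
def crOfRecord₁₃VCmap (Χ : (F : T4Family) → Stage13Params F N → ChiSlot F N) (jcut : ℕ → ℕ) (sh : ShellSplit₁₃CoPHCmap N Χ 0) :
    SpineReading₁₃CoPHCmap N Χ :=
  crOfRecord₁₃VAtCmap Χ 0 jcut sh

/-! ## §4 The dictionary (all `rfl`) -/

section Dictionary

variable (Χ : (F : T4Family) → Stage13Params F N → ChiSlot F N) (K₀ : ℕ) (jcut : ℕ → ℕ) (sh : ShellSplit₁₃CoPHCmap N Χ K₀) (θ : Stage13HParams F N)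
  (hP : θ.Provisos₁₃CoPHChi F N (Χ F θ.toStage13Params)) (g₀ : ℕ → ℝ) (os : List (ULoop F))

/-- `ι`. [bookkeeping] -/
theorem crOfRecord₁₃AtCmap_ι : (crOfRecord₁₃AtCmap Χ K₀ jcut sh F θ hP g₀ os).ι = (Σ K, SiteSeqKey F (K₀ + K)) := rfl
/-- `l₀ = 1`. [bookkeeping] -/
@[simp] theorem crOfRecord₁₃AtCmap_l₀ : (crOfRecord₁₃AtCmap Χ K₀ jcut sh F θ hP g₀ os).l₀ = 1 := rfl
/-- `vol = 1`. [bookkeeping] -/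
@[simp] theorem crOfRecord₁₃AtCmap_vol : (crOfRecord₁₃AtCmap Χ K₀ jcut sh F θ hP g₀ os).vol = 1 := rfl
/-- `K₀`. [bookkeeping] -/
@[simp] theorem crOfRecord₁₃AtCmap_K₀ : (crOfRecord₁₃AtCmap Χ K₀ jcut sh F θ hP g₀ os).K₀ = K₀ := rfl
/-- `T` = the χ-class set. [bookkeeping] -/
theorem crOfRecord₁₃AtCmap_T : (crOfRecord₁₃AtCmap Χ K₀ jcut sh F θ hP g₀ os).T = classSet₁₃Chi θ (Χ F θ.toStage13Params) K₀ g₀ := rfl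
/-- `A` = run A's χ-fibre sums. [bookkeeping] -/
theorem crOfRecord₁₃AtCmap_A : (crOfRecord₁₃AtCmap Χ K₀ jcut sh F θ hP g₀ os).A = weightA₁₃Chi θ (Χ F θ.toStage13Params) hP K₀ g₀ os := rfl
/-- `B` = run B's χ-fibre sums. [bookkeeping] -/
theorem crOfRecord₁₃AtCmap_B : (crOfRecord₁₃AtCmap Χ K₀ jcut sh F θ hP g₀ os).B = weightB₁₃Chi θ (Χ F θ.toStage13Params) hP K₀ g₀ os := rfl
/-- `Bad` = the χ-persistence class. [bookkeeping] -/
theorem crOfRecord₁₃AtCmap_Bad : (crOfRecord₁₃AtCmap Χ K₀ jcut sh F θ hP g₀ os).Bad = badClass₁₃Chi θ (Χ F θ.toStage13Params) K₀ g₀ jcut := rfl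
/-- `shA`. [bookkeeping] -/
theorem crOfRecord₁₃AtCmap_shA : (crOfRecord₁₃AtCmap Χ K₀ jcut sh F θ hP g₀ os).shA = (sh F θ hP g₀ os).1 := rfl
/-- `shB`. [bookkeeping] -/
theorem crOfRecord₁₃AtCmap_shB : (crOfRecord₁₃AtCmap Χ K₀ jcut sh F θ hP g₀ os).shB = (sh F θ hP g₀ os).2 := rfl
/-- `W` = the canonical relative weight of the χ-bad class. [bookkeeping] -/
theorem crOfRecord₁₃AtCmap_W : (crOfRecord₁₃AtCmap Χ K₀ jcut sh F θ hP g₀ os).W =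
    wInf 1 (classSet₁₃Chi θ (Χ F θ.toStage13Params) K₀ g₀) (weightA₁₃Chi θ (Χ F θ.toStage13Params) hP K₀ g₀ os)
      (weightB₁₃Chi θ (Χ F θ.toStage13Params) hP K₀ g₀ os) (badClass₁₃Chi θ (Χ F θ.toStage13Params) K₀ g₀ jcut) := rfl
/-- `Wsh` = the canonical relative shell weight. [bookkeeping] -/
theorem crOfRecord₁₃AtCmap_Wsh : (crOfRecord₁₃AtCmap Χ K₀ jcut sh F θ hP g₀ os).Wsh =
    wshInf 1 (classSet₁₃Chi θ (Χ F θ.toStage13Params) K₀ g₀) (weightA₁₃Chi θ (Χ F θ.toStage13Params) hP K₀ g₀ os)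
      (weightB₁₃Chi θ (Χ F θ.toStage13Params) hP K₀ g₀ os) (sh F θ hP g₀ os).1 (sh F θ hP g₀ os).2 := rfl
/-- `δ` = the canonical core-matching rate at `vol = 1`. [bookkeeping] -/
theorem crOfRecord₁₃AtCmap_δ : (crOfRecord₁₃AtCmap Χ K₀ jcut sh F θ hP g₀ os).δ =
    (letI : DecidableEq (Σ K, SiteSeqKey F (K₀ + K)) := Classical.decEq _
     deltaCan 1 1 (classSet₁₃Chi θ (Χ F θ.toStage13Params) K₀ g₀) (badClass₁₃Chi θ (Χ F θ.toStage13Params) K₀ g₀ jcut)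
      (fun K t x => weightA₁₃Chi θ (Χ F θ.toStage13Params) hP K₀ g₀ os K t x - (sh F θ hP g₀ os).1 K t x)
      (fun K t x => weightB₁₃Chi θ (Χ F θ.toStage13Params) hP K₀ g₀ os K t x - (sh F θ hP g₀ os).2 K t x)) := rfl
/-- The record χ-object reads the offset-`0` form. [bookkeeping] -/
theorem crOfRecord₁₃Cmap_eq (sh₀ : ShellSplit₁₃CoPHCmap N Χ 0) : crOfRecord₁₃Cmap Χ jcut sh₀ = crOfRecord₁₃AtCmap Χ 0 jcut sh₀ := rfl

/-- V-edition: `vol = F.side ^ 4`. [bookkeeping] -/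
theorem crOfRecord₁₃VAtCmap_vol : (crOfRecord₁₃VAtCmap Χ K₀ jcut sh F θ hP g₀ os).vol = F.side ^ 4 := rfl
/-- V-edition: `l₀ = 1`. [bookkeeping] -/
@[simp] theorem crOfRecord₁₃VAtCmap_l₀ : (crOfRecord₁₃VAtCmap Χ K₀ jcut sh F θ hP g₀ os).l₀ = 1 := rfl
/-- V-edition: `K₀`. [bookkeeping] -/
@[simp] theorem crOfRecord₁₃VAtCmap_K₀ : (crOfRecord₁₃VAtCmap Χ K₀ jcut sh F θ hP g₀ os).K₀ = K₀ := rfl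
/-- V-edition: `T`. [bookkeeping] -/
theorem crOfRecord₁₃VAtCmap_T : (crOfRecord₁₃VAtCmap Χ K₀ jcut sh F θ hP g₀ os).T = classSet₁₃Chi θ (Χ F θ.toStage13Params) K₀ g₀ := rfl
/-- V-edition: `A`. [bookkeeping] -/
theorem crOfRecord₁₃VAtCmap_A : (crOfRecord₁₃VAtCmap Χ K₀ jcut sh F θ hP g₀ os).A = weightA₁₃Chi θ (Χ F θ.toStage13Params) hP K₀ g₀ os := rfl
/-- V-edition: `B`. [bookkeeping] -/
theorem crOfRecord₁₃VAtCmap_B : (crOfRecord₁₃VAtCmap Χ K₀ jcut sh F θ hP g₀ os).B = weightB₁₃Chi θ (Χ F θ.toStage13Params) hP K₀ g₀ os := rfl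
/-- V-edition: `Bad`. [bookkeeping] -/
theorem crOfRecord₁₃VAtCmap_Bad : (crOfRecord₁₃VAtCmap Χ K₀ jcut sh F θ hP g₀ os).Bad = badClass₁₃Chi θ (Χ F θ.toStage13Params) K₀ g₀ jcut := rfl
/-- V-edition: `shA`. [bookkeeping] -/
theorem crOfRecord₁₃VAtCmap_shA : (crOfRecord₁₃VAtCmap Χ K₀ jcut sh F θ hP g₀ os).shA = (sh F θ hP g₀ os).1 := rfl
/-- V-edition: `shB`. [bookkeeping] -/
theorem crOfRecord₁₃VAtCmap_shB : (crOfRecord₁₃VAtCmap Χ K₀ jcut sh F θ hP g₀ os).shB = (sh F θ hP g₀ os).2 := rfl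
/-- V-edition: `W`. [bookkeeping] -/
theorem crOfRecord₁₃VAtCmap_W : (crOfRecord₁₃VAtCmap Χ K₀ jcut sh F θ hP g₀ os).W = (crOfRecord₁₃AtCmap Χ K₀ jcut sh F θ hP g₀ os).W := rfl
/-- V-edition: `Wsh`. [bookkeeping] -/
theorem crOfRecord₁₃VAtCmap_Wsh : (crOfRecord₁₃VAtCmap Χ K₀ jcut sh F θ hP g₀ os).Wsh = (crOfRecord₁₃AtCmap Χ K₀ jcut sh F θ hP g₀ os).Wsh := rfl
/-- V-edition: `δ` at `vol = F.side ^ 4`. [bookkeeping] -/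
theorem crOfRecord₁₃VAtCmap_δ : (crOfRecord₁₃VAtCmap Χ K₀ jcut sh F θ hP g₀ os).δ =
    (letI : DecidableEq (Σ K, SiteSeqKey F (K₀ + K)) := Classical.decEq _
     deltaCan 1 (F.side ^ 4) (classSet₁₃Chi θ (Χ F θ.toStage13Params) K₀ g₀) (badClass₁₃Chi θ (Χ F θ.toStage13Params) K₀ g₀ jcut)
      (fun K t x => weightA₁₃Chi θ (Χ F θ.toStage13Params) hP K₀ g₀ os K t x - (sh F θ hP g₀ os).1 K t x)
      (fun K t x => weightB₁₃Chi θ (Χ F θ.toStage13Params) hP K₀ g₀ os K t x - (sh F θ hP g₀ os).2 K t x)) := rfl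
/-- The V-record χ-object reads the offset-`0` form. [bookkeeping] -/
theorem crOfRecord₁₃VCmap_eq (sh₀ : ShellSplit₁₃CoPHCmap N Χ 0) : crOfRecord₁₃VCmap Χ jcut sh₀ = crOfRecord₁₃VAtCmap Χ 0 jcut sh₀ := rfl

end Dictionary

/-! ## §5 Receipts at the record's own β-slot `χ := chiβOfRecord₁₃ θ` (definitional) -/

section Receipts

variable (θ : Stage13HParams F N) (K₀ : ℕ) (g₀ : ℕ → ℝ) (os : List (ULoop F))

/-- Receipt: run A's χ-history at the record's β-slot IS `histA₁₃`. [bookkeeping] -/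
theorem histA₁₃Chi_chiβ (K : ℕ) : histA₁₃Chi θ (chiβOfRecord₁₃ F N θ.toStage13Params) K₀ g₀ K = histA₁₃ θ K₀ g₀ K := rfl
/-- Receipt: run B's χ-history at the record's β-slot IS `histB₁₃`. [bookkeeping] -/
theorem histB₁₃Chi_chiβ (K : ℕ) : histB₁₃Chi θ (chiβOfRecord₁₃ F N θ.toStage13Params) K₀ g₀ K = histB₁₃ θ K₀ g₀ K := rfl
/-- Receipt: run A's χ-key at the record's β-slot IS `keyA₁₃`. [bookkeeping] -/
theorem keyA₁₃Chi_chiβ (K : ℕ) (s : SeqOfRecord F θ.ν θ.τ9.M (histA₁₃ θ K₀ g₀ K) (K₀ + K) (K₀ + K)) :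
    keyA₁₃Chi θ (chiβOfRecord₁₃ F N θ.toStage13Params) K₀ g₀ K s = keyA₁₃ θ K₀ g₀ K s := rfl
/-- Receipt: run B's χ-key at the record's β-slot IS `keyB₁₃`. [bookkeeping] -/
theorem keyB₁₃Chi_chiβ (K : ℕ) (s' : SeqOfRecord F θ.ν θ.τ9.M (histB₁₃ θ K₀ g₀ K) (K₀ + K + 1) (K₀ + K + 1)) :
    keyB₁₃Chi θ (chiβOfRecord₁₃ F N θ.toStage13Params) K₀ g₀ K s' = keyB₁₃ θ K₀ g₀ K s' := rfl
/-- Receipt: the χ-class set at the record's β-slot IS `classSet₁₃`. [bookkeeping] -/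
theorem classSet₁₃Chi_chiβ (K : ℕ) : classSet₁₃Chi θ (chiβOfRecord₁₃ F N θ.toStage13Params) K₀ g₀ K = classSet₁₃ θ K₀ g₀ K := rfl
/-- Receipt: run A's χ-class weight at the record's β-slot IS `weightA₁₃` (provisos through `provisos₁₃CoPHChi_chiβ_iff`). [bookkeeping] -/
theorem weightA₁₃Chi_chiβ (hP : θ.Provisos₁₃CoPHChi F N (chiβOfRecord₁₃ F N θ.toStage13Params)) (K : ℕ) (t : ℝ) (x : Σ K, SiteSeqKey F (K₀ + K)) :
    weightA₁₃Chi θ (chiβOfRecord₁₃ F N θ.toStage13Params) hP K₀ g₀ os K t x = weightA₁₃ θ ((provisos₁₃CoPHChi_chiβ_iff θ).1 hP) K₀ g₀ os K t x := rfl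
/-- Receipt: run B's χ-class weight at the record's β-slot IS `weightB₁₃`. [bookkeeping] -/
theorem weightB₁₃Chi_chiβ (hP : θ.Provisos₁₃CoPHChi F N (chiβOfRecord₁₃ F N θ.toStage13Params)) (K : ℕ) (t : ℝ) (x : Σ K, SiteSeqKey F (K₀ + K)) :
    weightB₁₃Chi θ (chiβOfRecord₁₃ F N θ.toStage13Params) hP K₀ g₀ os K t x = weightB₁₃ θ ((provisos₁₃CoPHChi_chiβ_iff θ).1 hP) K₀ g₀ os K t x := rfl
/-- Receipt: the χ-bad class at the record's β-slot IS `badClass₁₃`. [bookkeeping] -/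
theorem badClass₁₃Chi_chiβ (jcut : ℕ → ℕ) (K : ℕ) (t : ℝ) :
    badClass₁₃Chi θ (chiβOfRecord₁₃ F N θ.toStage13Params) K₀ g₀ jcut K t = badClass₁₃ θ K₀ g₀ jcut K t := rfl

/-- Receipt: the χ-reading at the record's β-slot `Χ := chiβOfRecord₁₃` IS `crOfRecord₁₃At` at the transported provisos and the shell split read back through them. [bookkeeping] -/
theorem crOfRecord₁₃AtCmap_chiβ (jcut : ℕ → ℕ) (sh : ShellSplit₁₃CoPH N K₀)
    (hP : θ.Provisos₁₃CoPHChi F N (chiβOfRecord₁₃ F N θ.toStage13Params)) :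
    crOfRecord₁₃AtCmap (fun F => chiβOfRecord₁₃ F N) K₀ jcut (fun F θ h g₀ os => sh F θ ((provisos₁₃CoPHChi_chiβ_iff θ).1 h) g₀ os) F θ hP g₀ os =
      crOfRecord₁₃At K₀ jcut sh F θ ((provisos₁₃CoPHChi_chiβ_iff θ).1 hP) g₀ os := rfl

/-- Receipt, V-edition. [bookkeeping] -/
theorem crOfRecord₁₃VAtCmap_chiβ (jcut : ℕ → ℕ) (sh : ShellSplit₁₃CoPH N K₀)
    (hP : θ.Provisos₁₃CoPHChi F N (chiβOfRecord₁₃ F N θ.toStage13Params)) :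
    crOfRecord₁₃VAtCmap (fun F => chiβOfRecord₁₃ F N) K₀ jcut (fun F θ h g₀ os => sh F θ ((provisos₁₃CoPHChi_chiβ_iff θ).1 h) g₀ os) F θ hP g₀ os =
      crOfRecord₁₃VAt K₀ jcut sh F θ ((provisos₁₃CoPHChi_chiβ_iff θ).1 hP) g₀ os := rfl

end Receipts

/-! ## §6 The RE-CENTRED instances (`χ := chiβOfRecord₁₃Ax θ`) -/

section Ax

variable (θ : Stage13HParams F N) (K₀ : ℕ) (g₀ : ℕ → ℝ) (os : List (ULoop F))

/-- Run A's history of record, RE-CENTRED. [bookkeeping] -/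
abbrev histA₁₃Ax (K : ℕ) : ℕ → ℝ := histA₁₃Chi θ (chiβOfRecord₁₃Ax F N θ.toStage13Params) K₀ g₀ K
/-- Run B's history of record, RE-CENTRED. [bookkeeping] -/
abbrev histB₁₃Ax (K : ℕ) : ℕ → ℝ := histB₁₃Chi θ (chiβOfRecord₁₃Ax F N θ.toStage13Params) K₀ g₀ K
/-- The class set of record, RE-CENTRED. [bookkeeping] -/
abbrev classSet₁₃Ax (K : ℕ) : Finset (Σ K, SiteSeqKey F (K₀ + K)) := classSet₁₃Chi θ (chiβOfRecord₁₃Ax F N θ.toStage13Params) K₀ g₀ K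
/-- Run A's class weight of record, RE-CENTRED. [bookkeeping] -/
abbrev weightA₁₃Ax (hP : θ.Provisos₁₃CoPHAx F N) (K : ℕ) (t : ℝ) (x : Σ K, SiteSeqKey F (K₀ + K)) : ℝ :=
  weightA₁₃Chi θ (chiβOfRecord₁₃Ax F N θ.toStage13Params) hP K₀ g₀ os K t x
/-- Run B's class weight of record, RE-CENTRED. [bookkeeping] -/
abbrev weightB₁₃Ax (hP : θ.Provisos₁₃CoPHAx F N) (K : ℕ) (t : ℝ) (x : Σ K, SiteSeqKey F (K₀ + K)) : ℝ :=
  weightB₁₃Chi θ (chiβOfRecord₁₃Ax F N θ.toStage13Params) hP K₀ g₀ os K t x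
/-- The bad class of record, RE-CENTRED. [bookkeeping] -/
abbrev badClass₁₃Ax (jcut : ℕ → ℕ) (K : ℕ) (t : ℝ) : Finset (Σ K, SiteSeqKey F (K₀ + K)) :=
  badClass₁₃Chi θ (chiβOfRecord₁₃Ax F N θ.toStage13Params) K₀ g₀ jcut K t

end Ax

/-- The shell-split TYPE, RE-CENTRED. [bookkeeping] -/
abbrev ShellSplit₁₃CoPHAx (N : ℕ) [NeZero N] (K₀ : ℕ) : Type 1 := ShellSplit₁₃CoPHCmap N (fun F => chiβOfRecord₁₃Ax F N) K₀
/-- The spine reading of record at offset `K₀`, RE-CENTRED. [bookkeeping] -/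
abbrev crOfRecord₁₃AtAx (K₀ : ℕ) (jcut : ℕ → ℕ) (sh : ShellSplit₁₃CoPHAx N K₀) : SpineReading₁₃CoPHAx N :=
  crOfRecord₁₃AtCmap (fun F => chiβOfRecord₁₃Ax F N) K₀ jcut sh
/-- The spine reading of record, RE-CENTRED. [bookkeeping] -/
abbrev crOfRecord₁₃Ax (jcut : ℕ → ℕ) (sh : ShellSplit₁₃CoPHAx N 0) : SpineReading₁₃CoPHAx N :=
  crOfRecord₁₃Cmap (fun F => chiβOfRecord₁₃Ax F N) jcut sh
/-- The spine reading of record at offset `K₀`, physical volume letter, RE-CENTRED. [bookkeeping] -/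
abbrev crOfRecord₁₃VAtAx (K₀ : ℕ) (jcut : ℕ → ℕ) (sh : ShellSplit₁₃CoPHAx N K₀) : SpineReading₁₃CoPHAx N :=
  crOfRecord₁₃VAtCmap (fun F => chiβOfRecord₁₃Ax F N) K₀ jcut sh
/-- The spine reading of record, physical volume letter, RE-CENTRED. [bookkeeping] -/
abbrev crOfRecord₁₃VAx (jcut : ℕ → ℕ) (sh : ShellSplit₁₃CoPHAx N 0) : SpineReading₁₃CoPHAx N :=
  crOfRecord₁₃VCmap (fun F => chiβOfRecord₁₃Ax F N) jcut sh

/-! ## §7 Face transfers at the χ-readings: witnesses with ANY weights ∕ rate at the carriers give the faces AT the reading -/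

section Transfer

variable (Χ : (F : T4Family) → Stage13Params F N → ChiSlot F N) (K₀ : ℕ) (jcut : ℕ → ℕ) (sh : ShellSplit₁₃CoPHCmap N Χ K₀) (θ : Stage13HParams F N)
  (hP : θ.Provisos₁₃CoPHChi F N (Χ F θ.toStage13Params)) (g₀ : ℕ → ℝ) (os : List (ULoop F))

/-- ★ **N20 AT THE χ-READING FROM ANY WITNESS** (the reading's `W` is the canonical one). [bookkeeping] -/
theorem relWeightBound_crOfRecord₁₃AtCmap {W : ℕ → ℝ}
    (h : RelWeightBound 1 (classSet₁₃Chi θ (Χ F θ.toStage13Params) K₀ g₀) (weightA₁₃Chi θ (Χ F θ.toStage13Params) hP K₀ g₀ os)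
      (weightB₁₃Chi θ (Χ F θ.toStage13Params) hP K₀ g₀ os) (badClass₁₃Chi θ (Χ F θ.toStage13Params) K₀ g₀ jcut) W) :
    RelWeightBound (crOfRecord₁₃AtCmap Χ K₀ jcut sh F θ hP g₀ os).l₀ (crOfRecord₁₃AtCmap Χ K₀ jcut sh F θ hP g₀ os).T (crOfRecord₁₃AtCmap Χ K₀ jcut sh F θ hP g₀ os).A
      (crOfRecord₁₃AtCmap Χ K₀ jcut sh F θ hP g₀ os).B (crOfRecord₁₃AtCmap Χ K₀ jcut sh F θ hP g₀ os).Bad (crOfRecord₁₃AtCmap Χ K₀ jcut sh F θ hP g₀ os).W :=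
  relWeightBound_wInf h

/-- ★ **N21 AT THE χ-READING FROM ANY WITNESS**. [bookkeeping] -/
theorem shellWeightBound_crOfRecord₁₃AtCmap {Wsh : ℕ → ℝ}
    (h : ShellWeightBound 1 (classSet₁₃Chi θ (Χ F θ.toStage13Params) K₀ g₀) (weightA₁₃Chi θ (Χ F θ.toStage13Params) hP K₀ g₀ os)
      (weightB₁₃Chi θ (Χ F θ.toStage13Params) hP K₀ g₀ os) (sh F θ hP g₀ os).1 (sh F θ hP g₀ os).2 Wsh) :
    ShellWeightBound (crOfRecord₁₃AtCmap Χ K₀ jcut sh F θ hP g₀ os).l₀ (crOfRecord₁₃AtCmap Χ K₀ jcut sh F θ hP g₀ os).T (crOfRecord₁₃AtCmap Χ K₀ jcut sh F θ hP g₀ os).A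
      (crOfRecord₁₃AtCmap Χ K₀ jcut sh F θ hP g₀ os).B (crOfRecord₁₃AtCmap Χ K₀ jcut sh F θ hP g₀ os).shA (crOfRecord₁₃AtCmap Χ K₀ jcut sh F θ hP g₀ os).shB
      (crOfRecord₁₃AtCmap Χ K₀ jcut sh F θ hP g₀ os).Wsh :=
  shellWeightBound_wshInf h

/-- ★ **N20 AT THE χ-V-READING FROM ANY WITNESS**. [bookkeeping] -/
theorem relWeightBound_crOfRecord₁₃VAtCmap {W : ℕ → ℝ}
    (h : RelWeightBound 1 (classSet₁₃Chi θ (Χ F θ.toStage13Params) K₀ g₀) (weightA₁₃Chi θ (Χ F θ.toStage13Params) hP K₀ g₀ os)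
      (weightB₁₃Chi θ (Χ F θ.toStage13Params) hP K₀ g₀ os) (badClass₁₃Chi θ (Χ F θ.toStage13Params) K₀ g₀ jcut) W) :
    RelWeightBound (crOfRecord₁₃VAtCmap Χ K₀ jcut sh F θ hP g₀ os).l₀ (crOfRecord₁₃VAtCmap Χ K₀ jcut sh F θ hP g₀ os).T (crOfRecord₁₃VAtCmap Χ K₀ jcut sh F θ hP g₀ os).A
      (crOfRecord₁₃VAtCmap Χ K₀ jcut sh F θ hP g₀ os).B (crOfRecord₁₃VAtCmap Χ K₀ jcut sh F θ hP g₀ os).Bad (crOfRecord₁₃VAtCmap Χ K₀ jcut sh F θ hP g₀ os).W :=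
  relWeightBound_wInf h

/-- ★ **N21 AT THE χ-V-READING FROM ANY WITNESS**. [bookkeeping] -/
theorem shellWeightBound_crOfRecord₁₃VAtCmap {Wsh : ℕ → ℝ}
    (h : ShellWeightBound 1 (classSet₁₃Chi θ (Χ F θ.toStage13Params) K₀ g₀) (weightA₁₃Chi θ (Χ F θ.toStage13Params) hP K₀ g₀ os)
      (weightB₁₃Chi θ (Χ F θ.toStage13Params) hP K₀ g₀ os) (sh F θ hP g₀ os).1 (sh F θ hP g₀ os).2 Wsh) :
    ShellWeightBound (crOfRecord₁₃VAtCmap Χ K₀ jcut sh F θ hP g₀ os).l₀ (crOfRecord₁₃VAtCmap Χ K₀ jcut sh F θ hP g₀ os).T (crOfRecord₁₃VAtCmap Χ K₀ jcut sh F θ hP g₀ os).A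
      (crOfRecord₁₃VAtCmap Χ K₀ jcut sh F θ hP g₀ os).B (crOfRecord₁₃VAtCmap Χ K₀ jcut sh F θ hP g₀ os).shA (crOfRecord₁₃VAtCmap Χ K₀ jcut sh F θ hP g₀ os).shB
      (crOfRecord₁₃VAtCmap Χ K₀ jcut sh F θ hP g₀ os).Wsh :=
  shellWeightBound_wshInf h

end Transfer

end YMDAG.UVSplit

end
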